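import Literature.Analysis.FluidPDE.CKNPressureCZ
import Literature.Analysis.FluidPDE.CKNPressureDualityFar
import Literature.Analysis.FluidPDE.CKNScalingExtras
import Literature.Analysis.FunctionSpaces.LpDualityTestFunctions
import HarnessLib

/-!
# The local pressure estimate (Robinson–Rodrigo–Sadowski 2016, Lemma 16.7): discharge of `pressureEstimate`

Analysis/FluidPDE file in the decomposition of the named fact
`Literature.Analysis.FluidPDE.ckn_epsilon_regularity` (`PartialRegularity.lean`, ns.S12:
Caffarelli–Kohn–Nirenberg 1982, Proposition 2). It **proves** the decomposition target
`Literature.Analysis.FluidPDE.pressureEstimate` (`CKNEpsilonRegularityAssembly.lean`;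
Robinson–Rodrigo–Sadowski 2016, Lemma 16.7, after Kukavica 2009): absolute `κ₅, κ₆` with
`D(θr) ≤ κ₅ θ^{-3/2} A(r)^{3/4} E(r)^{3/4} + κ₆ θ D(r)` for every suitable weak solution
(`ν = 1`) with locally integrable, divergence-free force, every weak spatial gradient, every
cylinder with `closure Q_r(z) ⊆ Q` and every `θ ∈ (0, 1/2]`.

## Proof (the printed argument in dual form)

By parabolic scaling (`pressureEstimate_of_unitScale`, as in `CKNScalingExtras`) it suffices to
treat `r = 1`, `z = 0`. The printed proof (pp. 252–253) localises `p` with a cut-off `η` and the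
Newtonian kernel, `ηp = p₁ + … + p₅`, bounds the singular part `p₁ = Tᵢⱼ(ηUᵢⱼ)`,
`Uᵢⱼ = uᵢ(uⱼ - (uⱼ)₁)`, by the Calderón–Zygmund theorem and the regular parts by Young's
inequality, and integrates `‖p(t)‖^{3/2}_{L^{3/2}(B_θ)}` over `t ∈ (-θ², 0)`. Here the kernel is
put on the test-function side, as in the tree's treatment of Lemarié-Rieusset's (13.20): for
`θ' ∈ C_c^∞(Q_θ)`, `Q_θ = (-θ², 0) × B_θ`, and the slicewise truncated Newtonian potential
`Θ(t,·) = N_{1/4,1/2}[θ'(t,·)] ∈ C_c^∞(Q₁)`, the pressure equation gives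
`∫∫_{Q₁} p θ' = ∫∫_{Q₁} p Λθ' - ∫∫_{Q₁} D²Θ(u,u)`
(`IsDistributionalNSSolutionOn.integral_pressure_mul_test_eq`, `CKNPressureDuality`). The
smoothing term is the harmonic part `p₂ + … + p₅`:
`|∫∫ p Λθ'| ≤ L |B_θ|^{2/3} |B₁|^{1/3} D(1)^{2/3} ‖θ'‖_{L³}` (`CKNPressureDualityFar`, Hölder), and
the Calderón–Zygmund term is bounded in the mean-subtracted `L² × L⁶` form of the printed proof,
`|∫∫ D²Θ(u,u)| ≤ 9 C₃ C_SP A(1)^{1/2} E(1)^{1/2} θ^{1/3} ‖θ'‖_{L³}` (`CKNPressureCZ`, from Stein's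
Proposition 3 — the tree's theorem `stein1970_hessian_Lp_bound_holds_fin3` — the divergence-free
slices and the Sobolev–Poincaré inequality). The converse of Hölder's inequality
(`Literature.Analysis.FunctionSpaces.lintegral_rpow_enorm_le_of_forall_test`) turns the
resulting bound `|∫∫_{Q_θ} p θ'| ≤ K ‖θ'‖_{L³(Q_θ)}` into `∫∫_{Q_θ} |p|^{3/2} ≤ K^{3/2}`, i.e.
`θ⁻² ∫∫_{Q_θ} |p|^{3/2} ≤ c θ^{-3/2} A^{3/4} E^{3/4} + c θ D(1)` — the last display of p. 253.
The quantities `A(1), E(1), D(1)` are finite for suitable weak solutions around `closure Q₁`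
(`cknAEss_one_ne_top`, `cknE_one_ne_top` — any two weak spatial gradients agree a.e. —,
`cknD_one_ne_top`).

## References

* J. C. Robinson, J. L. Rodrigo, W. Sadowski, *The three-dimensional Navier–Stokes equations*,
  Cambridge Studies in Advanced Mathematics 157 (2016), Lemma 16.7 and its proof, pp. 251–253.
* I. Kukavica, *Partial regularity results for solutions of the Navier–Stokes system*, in
  *Partial differential equations and fluid mechanics*, LMS Lecture Notes 364 (2009), 121–145.
* L. Caffarelli, R. Kohn, L. Nirenberg, *Partial regularity of suitable weak solutions of the
  Navier–Stokes equations*, Comm. Pure Appl. Math. 35 (1982), §2.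
* E. M. Stein, *Singular integrals and differentiability properties of functions* (1970),
  Ch. III §1.3, Prop. 3.
-/

noncomputable section

open MeasureTheory Set Function Filter Topology TopologicalSpace Metric InnerProductSpace Module
open scoped ENNReal NNReal RealInnerProductSpace

namespace Literature.Analysis.FluidPDE

/-! ### Finiteness of `A(1)`, `E(1)`, `D(1)` for suitable weak solutions -/

section Finite

variable {Q : Opens (ℝ × EuclideanSpace ℝ (Fin 3))} {ν : ℝ}
  {f u : ℝ → EuclideanSpace ℝ (Fin 3) → EuclideanSpace ℝ (Fin 3)}
  {p : ℝ → EuclideanSpace ℝ (Fin 3) → ℝ}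
  {G : ℝ → EuclideanSpace ℝ (Fin 3) → EuclideanSpace ℝ (Fin 3) →L[ℝ] EuclideanSpace ℝ (Fin 3)}

/-- The closure of the unit cylinder is compact. [folklore] -/
theorem isCompact_closure_parabolicCylinder_one :
    IsCompact (closure (parabolicCylinder 1 (0 : ℝ × EuclideanSpace ℝ (Fin 3)))) := by
  refine (Bornology.IsBounded.isCompact_closure ?_)
  have hsub : parabolicCylinder 1 (0 : ℝ × EuclideanSpace ℝ (Fin 3)) ⊆
      Icc (-1 : ℝ) 0 ×ˢ closedBall (0 : EuclideanSpace ℝ (Fin 3)) 1 := by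
    have : parabolicCylinder 1 (0 : ℝ × EuclideanSpace ℝ (Fin 3)) =
        Ioo (-1 : ℝ) 0 ×ˢ ball (0 : EuclideanSpace ℝ (Fin 3)) 1 := by simp [parabolicCylinder]
    rw [this]
    exact prod_mono Ioo_subset_Icc_self ball_subset_closedBall
  exact ((isCompact_Icc.prod (isCompact_closedBall _ _)).isBounded).subset hsub

/-- **`A(1) < ∞`**: the energy class of a suitable weak solution bounds
`sup_t ∫_{B₁} |u(t)|²` when `closure Q₁ ⊆ Q`. [folklore] -/
theorem IsSuitableWeakSolutionOn.cknAEss_one_ne_top (h : IsSuitableWeakSolutionOn Q ν f u p)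
    (hcl : closure (parabolicCylinder 1 (0 : ℝ × EuclideanSpace ℝ (Fin 3))) ⊆
      (Q : Set (ℝ × EuclideanSpace ℝ (Fin 3)))) :
    cknAEss 1 0 u ≠ ∞ := by
  set K := closure (parabolicCylinder 1 (0 : ℝ × EuclideanSpace ℝ (Fin 3))) with hK
  obtain ⟨C, hC⟩ := h.energyClass K hcl isCompact_closure_parabolicCylinder_one
  have hcyl : parabolicCylinder 1 (0 : ℝ × EuclideanSpace ℝ (Fin 3)) =
      Ioo (-1 : ℝ) 0 ×ˢ ball (0 : EuclideanSpace ℝ (Fin 3)) 1 := by simp [parabolicCylinder]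
  have hQI : Ioo ((0 : ℝ × EuclideanSpace ℝ (Fin 3)).1 - 1 ^ 2) (0 : ℝ × EuclideanSpace ℝ (Fin 3)).1 =
      Ioo (-1 : ℝ) 0 := by simp
  have hbound : ∀ᵐ t ∂(volume.restrict (Ioo (-1 : ℝ) 0)),
      (ENNReal.ofReal (1 : ℝ))⁻¹ * ∫⁻ x in ball (0 : ℝ × EuclideanSpace ℝ (Fin 3)).2 1, ‖u t x‖ₑ ^ 2 ≤ C := by
    refine (ae_restrict_iff' measurableSet_Ioo).2 (hC.mono fun t ht htI => ?_)
    rw [ENNReal.ofReal_one, inv_one, one_mul, Prod.snd_zero]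
    refine le_trans ?_ ht
    rw [← lintegral_indicator measurableSet_ball]
    refine lintegral_mono fun x => ?_
    by_cases hx : x ∈ ball (0 : EuclideanSpace ℝ (Fin 3)) 1
    · have hz : (t, x) ∈ K := subset_closure (by rw [hcyl]; exact ⟨htI, hx⟩)
      rw [indicator_of_mem hx, indicator_of_mem hz]
    · rw [indicator_of_notMem hx]; exact zero_le
  have : cknAEss 1 0 u ≤ C := by
    simp only [cknAEss, hQI]
    exact essSup_le_of_ae_le _ hbound
  exact ne_top_of_le_ne_top ENNReal.coe_ne_top this

/-- **`D(1) < ∞`**: the pressure class of a suitable weak solution. [folklore] -/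
theorem IsSuitableWeakSolutionOn.cknD_one_ne_top (h : IsSuitableWeakSolutionOn Q ν f u p)
    (hcl : closure (parabolicCylinder 1 (0 : ℝ × EuclideanSpace ℝ (Fin 3))) ⊆
      (Q : Set (ℝ × EuclideanSpace ℝ (Fin 3)))) :
    cknD 1 0 p ≠ ∞ := by
  have hfin := h.pressure _ hcl isCompact_closure_parabolicCylinder_one
  simp only [cknD, ENNReal.ofReal_one, one_pow, inv_one, one_mul]
  exact (lt_of_le_of_lt (lintegral_mono_set subset_closure) hfin).ne

/-- **`E(1) < ∞` for every weak spatial gradient**: two weak spatial gradients of `u` on `Q`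
agree a.e. on `Q₁` (slice-wise uniqueness of weak derivatives), and the one provided by the
local energy inequality has `|∇u|² ∈ L¹(closure Q₁)`. [folklore] -/
theorem IsSuitableWeakSolutionOn.cknE_one_ne_top (h : IsSuitableWeakSolutionOn Q ν f u p)
    (hG : HasWeakSpatialGradientOn Q u G)
    (hcl : closure (parabolicCylinder 1 (0 : ℝ × EuclideanSpace ℝ (Fin 3))) ⊆
      (Q : Set (ℝ × EuclideanSpace ℝ (Fin 3)))) :
    cknE 1 0 G ≠ ∞ := by
  obtain ⟨G₀, hG₀, hG₀fin, -⟩ := h.localEnergy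
  have hfin := hG₀fin _ hcl isCompact_closure_parabolicCylinder_one
  set I : Set ℝ := Ioo (-1) 0 with hI
  set B : Set (EuclideanSpace ℝ (Fin 3)) := ball 0 1 with hB
  have hcyl : parabolicCylinder 1 (0 : ℝ × EuclideanSpace ℝ (Fin 3)) = I ×ˢ B := by
    simp [parabolicCylinder, hI, hB]
  have hQI : Ioo ((0 : ℝ × EuclideanSpace ℝ (Fin 3)).1 - 1 ^ 2) (0 : ℝ × EuclideanSpace ℝ (Fin 3)).1 = I := by
    simp [hI]
  have hle : parabolicCylinderOpens 1 (0 : ℝ × EuclideanSpace ℝ (Fin 3)) ≤ Q := by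
    intro z hz
    have hz' : z ∈ parabolicCylinder 1 (0 : ℝ × EuclideanSpace ℝ (Fin 3)) := by
      rwa [← coe_parabolicCylinderOpens]
    exact hcl (subset_closure hz')
  have hG₁ := hG.mono hle
  have hG₀₁ := hG₀.mono hle
  -- measurability on `I × B`
  have hQsub : I ×ˢ B ⊆ ((parabolicCylinderOpens 1 (0 : ℝ × EuclideanSpace ℝ (Fin 3)) :
      Opens (ℝ × EuclideanSpace ℝ (Fin 3))) : Set (ℝ × EuclideanSpace ℝ (Fin 3))) := by
    rw [coe_parabolicCylinderOpens, hcyl]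
  have hprod : (volume.restrict (I ×ˢ B) : Measure (ℝ × EuclideanSpace ℝ (Fin 3))) =
      (volume.restrict I).prod (volume.restrict B) := by
    rw [Measure.volume_eq_prod, Measure.prod_restrict]
  have hmeas : ∀ {G' : ℝ → EuclideanSpace ℝ (Fin 3) → EuclideanSpace ℝ (Fin 3) →L[ℝ] EuclideanSpace ℝ (Fin 3)},
      HasWeakSpatialGradientOn (parabolicCylinderOpens 1 (0 : ℝ × EuclideanSpace ℝ (Fin 3))) u G' →
      AEMeasurable (fun q : ℝ × EuclideanSpace ℝ (Fin 3) => ENNReal.ofReal (frobeniusNormSq (G' q.1 q.2)))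
        ((volume.restrict I).prod (volume.restrict B)) := by
    intro G' hG'
    rw [← hprod]
    exact (continuous_frobeniusNormSq'.comp_aestronglyMeasurable
      ((hG'.locallyIntegrableOn_grad.mono_set hQsub).aestronglyMeasurable)).aemeasurable.ennreal_ofReal
  -- slice-wise uniqueness
  have h1 : ∀ᵐ t ∂(volume.restrict I), FunctionSpaces.HasWeakFDerivOn
      (⟨B, isOpen_ball⟩ : Opens (EuclideanSpace ℝ (Fin 3))) volume (u t) (G t) := by
    have := hG₁.ae_hasWeakFDerivOn_ball; rwa [hQI] at this
  have h2 : ∀ᵐ t ∂(volume.restrict I), FunctionSpaces.HasWeakFDerivOn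
      (⟨B, isOpen_ball⟩ : Opens (EuclideanSpace ℝ (Fin 3))) volume (u t) (G₀ t) := by
    have := hG₀₁.ae_hasWeakFDerivOn_ball; rwa [hQI] at this
  have hae : ∀ᵐ t ∂(volume.restrict I),
      ∫⁻ x in B, ENNReal.ofReal (frobeniusNormSq (G t x)) =
        ∫⁻ x in B, ENNReal.ofReal (frobeniusNormSq (G₀ t x)) := by
    filter_upwards [h1, h2] with t ht1 ht2
    have heq := FunctionSpaces.HasWeakFDerivOn.unique_holds ht1 ht2
    exact lintegral_congr_ae (heq.mono fun x hx => by simp only [hx])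
  -- Tonelli on both sides
  have e1 : cknE 1 0 G = ∫⁻ t in I, ∫⁻ x in B, ENNReal.ofReal (frobeniusNormSq (G t x)) := by
    rw [cknE, ENNReal.ofReal_one, inv_one, one_mul, hcyl, Measure.volume_eq_prod,
      setLIntegral_prod _ (by rw [← Measure.prod_restrict]; exact hmeas hG₁)]
  have e2 : ∫⁻ z in I ×ˢ B, ENNReal.ofReal (frobeniusNormSq (G₀ z.1 z.2)) =
      ∫⁻ t in I, ∫⁻ x in B, ENNReal.ofReal (frobeniusNormSq (G₀ t x)) := by
    rw [Measure.volume_eq_prod, setLIntegral_prod _ (by rw [← Measure.prod_restrict]; exact hmeas hG₀₁)]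
  rw [e1, lintegral_congr_ae hae, ← e2]
  exact (lt_of_le_of_lt (lintegral_mono_set (hcyl ▸ subset_closure)) hfin).ne

end Finite

/-! ### The smoothing (harmonic) part of the tested pressure at unit scale -/

section Far

/-- **The harmonic part, unit scale.** For `p` measurable on `Q₁ = (-1, 0) × B₁`,
`θ' ∈ C_c^∞((-θ², 0) × B_θ)`, `θ² ≤ 1`, `ρ > 0`, `|λ_{ρ/2,ρ}| ≤ L`:
`|∫∫_{Q₁} p Λθ'| ≤ L |B₁| θ² D(1)^{2/3} ‖θ'‖_{L³}` (the tree's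
`enorm_setIntegral_mul_newtonFarSmoothing_le` with exponents `3/2, 3`, then Hölder on each
slice `∫_{B₁}|p(t)| ≤ |B₁|^{1/3} ‖p(t)‖_{L^{3/2}(B₁)}` and `|B_θ|^{2/3} = θ² |B₁|^{2/3}`;
Robinson–Rodrigo–Sadowski 2016, p. 253, the bounds for `p₂, …, p₅`).
[cite: RobinsonRodrigoSadowski2016, proof of Lemma 16.7 p. 253] -/
theorem enorm_integral_pressure_mul_newtonFarSmoothing_le_unitScale
    {p : ℝ → EuclideanSpace ℝ (Fin 3) → ℝ}
    (hpm : AEStronglyMeasurable (uncurry p)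
      (volume.restrict (parabolicCylinder 1 (0 : ℝ × EuclideanSpace ℝ (Fin 3)))))
    {ρ : ℝ} {L : ℝ≥0} (hL : ∀ z, ‖newtonFarLaplacian (ρ / 2) ρ z‖ ≤ L)
    {θ : ℝ} (hθ : 0 < θ) (hθ1 : θ ^ 2 ≤ 1)
    {θ' : ℝ → EuclideanSpace ℝ (Fin 3) → ℝ}
    (hθ' : IsSpaceTimeTestOn (⟨Ioo (-θ ^ 2) 0 ×ˢ ball (0 : EuclideanSpace ℝ (Fin 3)) θ,
      isOpen_Ioo.prod isOpen_ball⟩ : Opens (ℝ × EuclideanSpace ℝ (Fin 3))) θ') :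
    ‖∫ z in parabolicCylinder 1 (0 : ℝ × EuclideanSpace ℝ (Fin 3)),
        p z.1 z.2 * newtonFarSmoothing (ρ / 2) ρ (θ' z.1) z.2‖ₑ ≤
      L * volume (ball (0 : EuclideanSpace ℝ (Fin 3)) 1) * ENNReal.ofReal θ ^ 2 *
        cknD 1 0 p ^ (2 / 3 : ℝ) *
        (∫⁻ z in Ioo (-θ ^ 2) 0 ×ˢ ball (0 : EuclideanSpace ℝ (Fin 3)) θ,
          ‖θ' z.1 z.2‖ₑ ^ (3 : ℝ)) ^ (1 / 3 : ℝ) := by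
  set I : Set ℝ := Ioo (-1) 0 with hI
  set B : Set (EuclideanSpace ℝ (Fin 3)) := ball 0 1 with hB
  set Iθ : Set ℝ := Ioo (-θ ^ 2) 0 with hIθ
  have hcyl : parabolicCylinder 1 (0 : ℝ × EuclideanSpace ℝ (Fin 3)) = I ×ˢ B := by
    simp [parabolicCylinder, hI, hB]
  have hIθI : Iθ ⊆ I := Ioo_subset_Ioo (by linarith) le_rfl
  have hpq : Real.HolderConjugate (3 / 2) 3 := Real.holderConjugate_iff.2 ⟨by norm_num, by norm_num⟩
  have hpm' : AEStronglyMeasurable (uncurry p) (volume.restrict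
      ((parabolicCylinderOpens 1 (0 : ℝ × EuclideanSpace ℝ (Fin 3)) :
        Opens (ℝ × EuclideanSpace ℝ (Fin 3))) : Set (ℝ × EuclideanSpace ℝ (Fin 3)))) := by
    rwa [coe_parabolicCylinderOpens]
  have key := enorm_setIntegral_mul_newtonFarSmoothing_le
    (Ω := parabolicCylinderOpens 1 (0 : ℝ × EuclideanSpace ℝ (Fin 3))) hpm' hL hθ' hpq
  rw [coe_parabolicCylinderOpens] at key
  refine key.trans ?_
  -- the volume factor
  have hvol : volume (ball (0 : EuclideanSpace ℝ (Fin 3)) θ) ^ (1 - 1 / 3 : ℝ) =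
      ENNReal.ofReal θ ^ 2 * volume B ^ (2 / 3 : ℝ) := by
    have h3 : (θ ^ 3) ^ (2 / 3 : ℝ) = θ ^ 2 := by
      rw [← Real.rpow_natCast, ← Real.rpow_mul hθ.le, show ((3 : ℕ) : ℝ) * (2 / 3) = 2 by norm_num,
        Real.rpow_two]
    rw [Measure.addHaar_ball volume (0 : EuclideanSpace ℝ (Fin 3)) hθ.le, finrank_euclideanSpace_fin,
      show (1 - 1 / 3 : ℝ) = 2 / 3 by norm_num, ENNReal.mul_rpow_of_nonneg _ _ (by norm_num),
      ENNReal.ofReal_rpow_of_nonneg (by positivity) (by norm_num), h3, ENNReal.ofReal_pow hθ.le]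
  -- the pressure factor
  have hprod : (volume.restrict (I ×ˢ B) : Measure (ℝ × EuclideanSpace ℝ (Fin 3))) =
      (volume.restrict I).prod (volume.restrict B) := by
    rw [Measure.volume_eq_prod, Measure.prod_restrict]
  have hpm2 : AEStronglyMeasurable (uncurry p) ((volume.restrict I).prod (volume.restrict B)) := by
    rw [← hprod, ← hcyl]; exact hpm
  have hslice : ∀ᵐ t ∂(volume.restrict I), AEStronglyMeasurable (fun x => p t x) (volume.restrict B) :=
    hpm2.prodMk_left
  have hD : cknD 1 0 p = ∫⁻ z in I ×ˢ B, ‖p z.1 z.2‖ₑ ^ (3 / 2 : ℝ) := by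
    simp only [cknD, ENNReal.ofReal_one, one_pow, inv_one, one_mul, hcyl]
  have hDeq : ∫⁻ t in Iθ, ∫⁻ x in B, ‖p t x‖ₑ ^ (3 / 2 : ℝ) ≤ cknD 1 0 p := by
    have hm : AEMeasurable (fun z : ℝ × EuclideanSpace ℝ (Fin 3) => ‖p z.1 z.2‖ₑ ^ (3 / 2 : ℝ))
        (((volume : Measure ℝ).prod (volume : Measure (EuclideanSpace ℝ (Fin 3)))).restrict (Iθ ×ˢ B)) := by
      rw [← Measure.prod_restrict]
      exact (hpm2.enorm.pow_const _).mono_measure (Measure.prod_mono (Measure.restrict_mono hIθI le_rfl) le_rfl)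
    rw [hD, ← setLIntegral_prod _ hm, ← Measure.volume_eq_prod]
    exact lintegral_mono_set (prod_mono hIθI Subset.rfl)
  have hmid : (∫⁻ t in Iθ, (∫⁻ x, (I ×ˢ B).indicator
      (fun z : ℝ × EuclideanSpace ℝ (Fin 3) => ‖p z.1 z.2‖ₑ) (t, x)) ^ (3 / 2 : ℝ)) ≤
      volume B ^ (1 / 2 : ℝ) * cknD 1 0 p := by
    have hae : ∀ᵐ t ∂(volume.restrict Iθ), (∫⁻ x, (I ×ˢ B).indicator
        (fun z : ℝ × EuclideanSpace ℝ (Fin 3) => ‖p z.1 z.2‖ₑ) (t, x)) ^ (3 / 2 : ℝ) ≤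
        volume B ^ (1 / 2 : ℝ) * ∫⁻ x in B, ‖p t x‖ₑ ^ (3 / 2 : ℝ) := by
      have hslice' := ae_restrict_of_ae_restrict_of_subset hIθI hslice
      filter_upwards [hslice', ae_restrict_mem measurableSet_Ioo] with t ht htI
      have htI' : t ∈ I := hIθI htI
      have hind : ∀ x, (I ×ˢ B).indicator (fun z : ℝ × EuclideanSpace ℝ (Fin 3) => ‖p z.1 z.2‖ₑ) (t, x) =
          B.indicator (fun x => ‖p t x‖ₑ) x := by
        intro x
        by_cases hx : x ∈ B
        · rw [indicator_of_mem (mk_mem_prod htI' hx), indicator_of_mem hx]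
        · rw [indicator_of_notMem hx, indicator_of_notMem (fun h => hx h.2)]
      simp_rw [hind]
      rw [lintegral_indicator measurableSet_ball]
      -- Hölder against `1` on `B`
      have hH := setLIntegral_rpow_le_rpow_mul_measure volume B (F := fun x => ‖p t x‖ₑ)
        ht.enorm (a := 1) (b := 3 / 2) one_pos (by norm_num)
      simp only [ENNReal.rpow_one] at hH
      calc (∫⁻ x in B, ‖p t x‖ₑ) ^ (3 / 2 : ℝ)
          ≤ ((∫⁻ x in B, ‖p t x‖ₑ ^ (3 / 2 : ℝ)) ^ (1 / (3 / 2) : ℝ) * volume B ^ (1 - 1 / (3 / 2) : ℝ)) ^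
              (3 / 2 : ℝ) := ENNReal.rpow_le_rpow hH (by norm_num)
        _ = volume B ^ (1 / 2 : ℝ) * ∫⁻ x in B, ‖p t x‖ₑ ^ (3 / 2 : ℝ) := by
            rw [ENNReal.mul_rpow_of_nonneg _ _ (by norm_num), ← ENNReal.rpow_mul, ← ENNReal.rpow_mul]
            norm_num
            rw [mul_comm]
    calc _ ≤ ∫⁻ t in Iθ, volume B ^ (1 / 2 : ℝ) * ∫⁻ x in B, ‖p t x‖ₑ ^ (3 / 2 : ℝ) := lintegral_mono_ae hae
      _ = volume B ^ (1 / 2 : ℝ) * ∫⁻ t in Iθ, ∫⁻ x in B, ‖p t x‖ₑ ^ (3 / 2 : ℝ) := by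
          rw [lintegral_const_mul' _ _ (ENNReal.rpow_ne_top_of_nonneg (by norm_num) measure_ball_lt_top.ne)]
      _ ≤ volume B ^ (1 / 2 : ℝ) * cknD 1 0 p := mul_le_mul' le_rfl hDeq
  have hmid' : (∫⁻ t in Iθ, (∫⁻ x, (I ×ˢ B).indicator
      (fun z : ℝ × EuclideanSpace ℝ (Fin 3) => ‖p z.1 z.2‖ₑ) (t, x)) ^ (3 / 2 : ℝ)) ^ (1 / (3 / 2) : ℝ) ≤
      volume B ^ (1 / 3 : ℝ) * cknD 1 0 p ^ (2 / 3 : ℝ) := by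
    rw [show (1 / (3 / 2) : ℝ) = 2 / 3 by norm_num]
    refine (ENNReal.rpow_le_rpow hmid (by norm_num)).trans (le_of_eq ?_)
    rw [ENNReal.mul_rpow_of_nonneg _ _ (by norm_num), ← ENNReal.rpow_mul]
    norm_num
  -- assemble
  have hBvol : volume B ^ (2 / 3 : ℝ) * volume B ^ (1 / 3 : ℝ) = volume B := by
    rw [← ENNReal.rpow_add_of_nonneg _ _ (by norm_num) (by norm_num)]
    norm_num
  rw [hcyl, hvol]
  calc (L : ℝ≥0∞) * (ENNReal.ofReal θ ^ 2 * volume B ^ (2 / 3 : ℝ)) *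
        (∫⁻ t in Iθ, (∫⁻ x, (I ×ˢ B).indicator
          (fun z : ℝ × EuclideanSpace ℝ (Fin 3) => ‖p z.1 z.2‖ₑ) (t, x)) ^ (3 / 2 : ℝ)) ^ (1 / (3 / 2) : ℝ) *
        (∫⁻ z in Iθ ×ˢ ball (0 : EuclideanSpace ℝ (Fin 3)) θ, ‖θ' z.1 z.2‖ₑ ^ (3 : ℝ)) ^ (1 / 3 : ℝ)
      ≤ L * (ENNReal.ofReal θ ^ 2 * volume B ^ (2 / 3 : ℝ)) * (volume B ^ (1 / 3 : ℝ) * cknD 1 0 p ^ (2 / 3 : ℝ)) *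
        (∫⁻ z in Iθ ×ˢ ball (0 : EuclideanSpace ℝ (Fin 3)) θ, ‖θ' z.1 z.2‖ₑ ^ (3 : ℝ)) ^ (1 / 3 : ℝ) := by
        gcongr
    _ = L * (volume B ^ (2 / 3 : ℝ) * volume B ^ (1 / 3 : ℝ)) * ENNReal.ofReal θ ^ 2 *
        cknD 1 0 p ^ (2 / 3 : ℝ) *
        (∫⁻ z in Iθ ×ˢ ball (0 : EuclideanSpace ℝ (Fin 3)) θ, ‖θ' z.1 z.2‖ₑ ^ (3 : ℝ)) ^ (1 / 3 : ℝ) := by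
        ring
    _ = L * volume B * ENNReal.ofReal θ ^ 2 * cknD 1 0 p ^ (2 / 3 : ℝ) *
        (∫⁻ z in Iθ ×ˢ ball (0 : EuclideanSpace ℝ (Fin 3)) θ, ‖θ' z.1 z.2‖ₑ ^ (3 : ℝ)) ^ (1 / 3 : ℝ) := by
        rw [hBvol]

end Far

/-! ### The duality argument at unit scale -/

section Duality

set_option maxHeartbeats 800000 in
-- the test-function bound assembles several long statements; the bump covers this proof only
/-- **Lemma 16.7 at unit scale, dual form.** Let `(u, p)` be a suitable weak solution (`ν = 1`)
on `Q` with locally integrable, divergence-free force, `G` a weak spatial gradient,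
`closure Q₁ ⊆ Q`, `0 < θ ≤ 1/2`. With a Calderón–Zygmund constant `C₃` at exponent `3`, a
Sobolev–Poincaré constant `C_SP` and a bound `L` for the smoothing kernel `λ_{1/4,1/2}`,
`∫∫_{Q_θ} |p|^{3/2} ≤ (9 C₃ C_SP A(1)^{1/2} E(1)^{1/2} θ^{1/3} + L |B₁| θ² D(1)^{2/3})^{3/2}`:
for every `θ' ∈ C_c^∞(Q_θ)`, `∫∫ p θ' = ∫∫ p Λθ' - ∫∫ D²Θ(u,u)` is bounded by `K ‖θ'‖_{L³}`
(`enorm_integral_pressure_mul_newtonFarSmoothing_le_unitScale`,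
`enorm_integral_hessian_le_meanZero_unitScale`), and the converse of Hölder's inequality
concludes (Robinson–Rodrigo–Sadowski 2016, p. 253, the display before "and so").
[cite: RobinsonRodrigoSadowski2016, proof of Lemma 16.7 pp. 252–253] -/
theorem setLIntegral_pressure_rpow_le_unitScale {C₃ : ℝ≥0}
    (hC₃ : ∀ ⦃r : ℝ⦄, 0 < r → ∀ ⦃g : EuclideanSpace ℝ (Fin 3) → ℝ⦄, ContDiff ℝ 2 g →
      HasCompactSupport g → ∀ a b : EuclideanSpace ℝ (Fin 3), ‖a‖ ≤ 1 → ‖b‖ ≤ 1 →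
        eLpNorm (fun x => fderiv ℝ (fun y => fderiv ℝ (newtonNearPotential (r / 2) r g) y a) x b)
            3 volume ≤ C₃ * eLpNorm g 3 volume)
    {CSP : ℝ≥0}
    (hCSP : ∀ (v : EuclideanSpace ℝ (Fin 3) → EuclideanSpace ℝ (Fin 3))
      (Dv : EuclideanSpace ℝ (Fin 3) → EuclideanSpace ℝ (Fin 3) →L[ℝ] EuclideanSpace ℝ (Fin 3)),
      FunctionSpaces.MemSobolevDomain 1 2
        (⟨ball (0 : EuclideanSpace ℝ (Fin 3)) 1, isOpen_ball⟩ : Opens (EuclideanSpace ℝ (Fin 3)))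
        volume v →
      FunctionSpaces.HasWeakFDerivOn
        (⟨ball (0 : EuclideanSpace ℝ (Fin 3)) 1, isOpen_ball⟩ : Opens (EuclideanSpace ℝ (Fin 3)))
        volume v Dv →
      eLpNorm (fun x => v x - ⨍ y in ball (0 : EuclideanSpace ℝ (Fin 3)) 1, v y) 6
          (volume.restrict (ball (0 : EuclideanSpace ℝ (Fin 3)) 1)) ≤
        CSP * eLpNorm Dv 2 (volume.restrict (ball (0 : EuclideanSpace ℝ (Fin 3)) 1)))
    {L : ℝ≥0} (hL : ∀ z, ‖newtonFarLaplacian ((1 / 2 : ℝ) / 2) (1 / 2) z‖ ≤ L)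
    {Q : Opens (ℝ × EuclideanSpace ℝ (Fin 3))}
    {f u : ℝ → EuclideanSpace ℝ (Fin 3) → EuclideanSpace ℝ (Fin 3)}
    {p : ℝ → EuclideanSpace ℝ (Fin 3) → ℝ}
    {G : ℝ → EuclideanSpace ℝ (Fin 3) → EuclideanSpace ℝ (Fin 3) →L[ℝ] EuclideanSpace ℝ (Fin 3)}
    (hsol : IsSuitableWeakSolutionOn Q 1 f u p)
    (hfi : LocallyIntegrableOn (uncurry f) (Q : Set (ℝ × EuclideanSpace ℝ (Fin 3))) volume)
    (hdivf : ∀ φ : ℝ → EuclideanSpace ℝ (Fin 3) → ℝ, IsSpaceTimeTestOn Q φ →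
      ∫ t, ∫ x, ⟪f t x, gradient (φ t) x⟫ = 0)
    (hG : HasWeakSpatialGradientOn Q u G)
    (hcl : closure (parabolicCylinder 1 (0 : ℝ × EuclideanSpace ℝ (Fin 3))) ⊆
      (Q : Set (ℝ × EuclideanSpace ℝ (Fin 3))))
    {θ : ℝ} (hθ : 0 < θ) (hθ2 : θ ≤ 1 / 2) :
    ∫⁻ z in parabolicCylinder θ (0 : ℝ × EuclideanSpace ℝ (Fin 3)), ‖p z.1 z.2‖ₑ ^ (3 / 2 : ℝ) ≤
      (9 * C₃ * CSP * cknAEss 1 0 u ^ (1 / 2 : ℝ) * cknE 1 0 G ^ (1 / 2 : ℝ) *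
          ENNReal.ofReal θ ^ (1 / 3 : ℝ) +
        L * volume (ball (0 : EuclideanSpace ℝ (Fin 3)) 1) * ENNReal.ofReal θ ^ 2 *
          cknD 1 0 p ^ (2 / 3 : ℝ)) ^ (3 / 2 : ℝ) := by
  -- finiteness
  have hA := hsol.cknAEss_one_ne_top hcl
  have hE := hsol.cknE_one_ne_top hG hcl
  have hD := hsol.cknD_one_ne_top hcl
  set K : ℝ≥0∞ := 9 * C₃ * CSP * cknAEss 1 0 u ^ (1 / 2 : ℝ) * cknE 1 0 G ^ (1 / 2 : ℝ) *
      ENNReal.ofReal θ ^ (1 / 3 : ℝ) +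
    L * volume (ball (0 : EuclideanSpace ℝ (Fin 3)) 1) * ENNReal.ofReal θ ^ 2 * cknD 1 0 p ^ (2 / 3 : ℝ)
    with hK
  have hKtop : K ≠ ∞ := by
    refine ENNReal.add_ne_top.2 ⟨?_, ?_⟩
    · refine ENNReal.mul_ne_top (ENNReal.mul_ne_top (ENNReal.mul_ne_top (by simp [ENNReal.mul_ne_top])
        (ENNReal.rpow_ne_top_of_nonneg (by norm_num) hA)) (ENNReal.rpow_ne_top_of_nonneg (by norm_num) hE))
        (ENNReal.rpow_ne_top_of_nonneg (by norm_num) ENNReal.ofReal_ne_top)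
    · exact ENNReal.mul_ne_top (ENNReal.mul_ne_top (ENNReal.mul_ne_top ENNReal.coe_ne_top
        measure_ball_lt_top.ne) (ENNReal.pow_ne_top ENNReal.ofReal_ne_top))
        (ENNReal.rpow_ne_top_of_nonneg (by norm_num) hD)
  -- sets
  set S : Set (ℝ × EuclideanSpace ℝ (Fin 3)) := Ioo (-θ ^ 2) 0 ×ˢ ball (0 : EuclideanSpace ℝ (Fin 3)) θ
    with hS
  have hSeq : parabolicCylinder θ (0 : ℝ × EuclideanSpace ℝ (Fin 3)) = S := by
    simp [parabolicCylinder, hS]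
  have hSo : IsOpen S := isOpen_Ioo.prod isOpen_ball
  set I : Set ℝ := Ioo (-1) 0 with hI
  set B : Set (EuclideanSpace ℝ (Fin 3)) := ball 0 1 with hB
  have hcyl : parabolicCylinder 1 (0 : ℝ × EuclideanSpace ℝ (Fin 3)) = I ×ˢ B := by
    simp [parabolicCylinder, hI, hB]
  have hθ1 : θ ^ 2 ≤ 1 := by nlinarith
  have hSQ₁ : S ⊆ I ×ˢ B := prod_mono (Ioo_subset_Ioo (by linarith) le_rfl) (ball_subset_ball (by linarith))
  -- restriction to `Q₁`
  have hle : parabolicCylinderOpens 1 (0 : ℝ × EuclideanSpace ℝ (Fin 3)) ≤ Q := by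
    intro z hz
    have hz' : z ∈ parabolicCylinder 1 (0 : ℝ × EuclideanSpace ℝ (Fin 3)) := by
      rwa [← coe_parabolicCylinderOpens]
    exact hcl (subset_closure hz')
  have h₁ : IsSuitableWeakSolutionOn (parabolicCylinderOpens 1 (0 : ℝ × EuclideanSpace ℝ (Fin 3))) 1 f u p :=
    hsol.of_le hle
  have hG₁ := hG.mono hle
  have hfi₁ : LocallyIntegrableOn (uncurry f)
      ((parabolicCylinderOpens 1 (0 : ℝ × EuclideanSpace ℝ (Fin 3)) :
        Opens (ℝ × EuclideanSpace ℝ (Fin 3))) : Set (ℝ × EuclideanSpace ℝ (Fin 3))) volume :=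
    hfi.mono_set hle
  have hdivf₁ : ∀ φ : ℝ → EuclideanSpace ℝ (Fin 3) → ℝ,
      IsSpaceTimeTestOn (parabolicCylinderOpens 1 (0 : ℝ × EuclideanSpace ℝ (Fin 3))) φ →
      ∫ t, ∫ x, ⟪f t x, gradient (φ t) x⟫ = 0 := fun φ hφ => hdivf φ (hφ.mono hle)
  have hdivu : ∀ ϑ : ℝ → EuclideanSpace ℝ (Fin 3) → ℝ,
      IsSpaceTimeTestOn (parabolicCylinderOpens 1 (0 : ℝ × EuclideanSpace ℝ (Fin 3))) ϑ →
      ∫ z in parabolicCylinder 1 (0 : ℝ × EuclideanSpace ℝ (Fin 3)),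
        ⟪u z.1 z.2, gradient (ϑ z.1) z.2⟫ = 0 := h₁.distributional.2.2.2.1
  have hu2 : LocallyIntegrableOn (fun z : ℝ × EuclideanSpace ℝ (Fin 3) => ‖u z.1 z.2‖ ^ 2)
      (parabolicCylinder 1 (0 : ℝ × EuclideanSpace ℝ (Fin 3))) volume := h₁.distributional.2.1
  have hpm : AEStronglyMeasurable (uncurry p)
      (volume.restrict (parabolicCylinder 1 (0 : ℝ × EuclideanSpace ℝ (Fin 3)))) :=
    h₁.distributional.2.2.1.aestronglyMeasurable
  have hsub : Ioo (-θ ^ 2) 0 ×ˢ ball (0 : EuclideanSpace ℝ (Fin 3)) (θ + 1 / 2) ⊆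
      ((parabolicCylinderOpens 1 (0 : ℝ × EuclideanSpace ℝ (Fin 3)) :
        Opens (ℝ × EuclideanSpace ℝ (Fin 3))) : Set (ℝ × EuclideanSpace ℝ (Fin 3))) := by
    rw [coe_parabolicCylinderOpens, hcyl]
    exact prod_mono (Ioo_subset_Ioo (by linarith) le_rfl) (ball_subset_ball (by linarith))
  -- integrability of `p` on `S`
  have hpS : IntegrableOn (uncurry p) S volume := by
    have hK : closure S ⊆ (Q : Set (ℝ × EuclideanSpace ℝ (Fin 3))) :=
      (closure_mono (hSQ₁.trans (hcyl ▸ Subset.rfl))).trans hcl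
    have hKc : IsCompact (closure S) :=
      (isCompact_closure_parabolicCylinder_one.of_isClosed_subset isClosed_closure
        (closure_mono (hSQ₁.trans (hcyl ▸ Subset.rfl))))
    exact (hsol.distributional.2.2.1.integrableOn_compact_subset hK hKc).mono_set subset_closure
  -- ### the converse of Hölder's inequality
  have hpq : Real.HolderConjugate (3 / 2) 3 := Real.holderConjugate_iff.2 ⟨by norm_num, by norm_num⟩
  haveI : (volume : Measure (ℝ × EuclideanSpace ℝ (Fin 3))).IsAddHaarMeasure := by
    rw [Measure.volume_eq_prod]; infer_instance
  have key := FunctionSpaces.lintegral_rpow_enorm_le_of_forall_test (μ := volume) hSo hpS hpq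
    (M := K.toReal) ENNReal.toReal_nonneg ?_
  · rw [hSeq]
    refine key.trans (le_of_eq ?_)
    rw [← ENNReal.ofReal_rpow_of_nonneg ENNReal.toReal_nonneg (by norm_num), ENNReal.ofReal_toReal hKtop]
  -- ### the bound for one test function
  intro Ψ hΨ hΨc hΨS
  set θ' : ℝ → EuclideanSpace ℝ (Fin 3) → ℝ := fun t x => Ψ (t, x) with hθ'def
  have hθ' : IsSpaceTimeTestOn (⟨Ioo (-θ ^ 2) 0 ×ˢ ball (0 : EuclideanSpace ℝ (Fin 3)) θ,
      isOpen_Ioo.prod isOpen_ball⟩ : Opens (ℝ × EuclideanSpace ℝ (Fin 3))) θ' := ⟨hΨ, hΨc, hΨS⟩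
  have hΨ0 : ∀ z, z ∉ S → Ψ z = 0 := fun z hz => image_eq_zero_of_notMem_tsupport fun h => hz (hΨS h)
  -- the tested pressure equation
  have hid := h₁.distributional.integral_pressure_mul_test_eq hfi₁ hdivf₁ (ρ := 1 / 2) (by norm_num)
    hsub hθ'
  rw [coe_parabolicCylinderOpens] at hid
  -- `∫_S p Ψ = ∫∫_{Q₁} p θ'`
  have hLHS : ∫ z in S, uncurry p z * Ψ z =
      ∫ z in parabolicCylinder 1 (0 : ℝ × EuclideanSpace ℝ (Fin 3)), p z.1 z.2 * θ' z.1 z.2 := by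
    rw [setIntegral_eq_integral_of_forall_compl_eq_zero (fun z hz => by rw [hΨ0 z hz, mul_zero]),
      setIntegral_eq_integral_of_forall_compl_eq_zero (fun z hz => ?_)]
    · rfl
    · change p z.1 z.2 * Ψ (z.1, z.2) = 0
      rw [Prod.mk.eta, hΨ0 z (fun h => hz (hcyl ▸ hSQ₁ h)), mul_zero]
  -- the two bounds
  have hfar := enorm_integral_pressure_mul_newtonFarSmoothing_le_unitScale hpm hL hθ hθ1 hθ'
  have hcz := enorm_integral_hessian_le_meanZero_unitScale hC₃ hCSP hG₁ hu2 hdivu hA hE hθ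
    (ρ := 1 / 2) (by norm_num) (by linarith) hθ1 hθ'
  set T : ℝ≥0∞ := ∫⁻ z in Ioo (-θ ^ 2) 0 ×ˢ ball (0 : EuclideanSpace ℝ (Fin 3)) θ, ‖θ' z.1 z.2‖ₑ ^ (3 : ℝ)
    with hT
  have hsupp : support (fun z : ℝ × EuclideanSpace ℝ (Fin 3) => ‖Ψ z‖ₑ ^ (3 : ℝ)) ⊆ S := by
    intro z hz
    by_contra hzS
    exact hz (by simp [hΨ0 z hzS, ENNReal.zero_rpow_of_pos (by norm_num : (0 : ℝ) < 3)])
  have hTeq : T = ∫⁻ z, ‖Ψ z‖ₑ ^ (3 : ℝ) := by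
    rw [hT]
    exact setLIntegral_eq_of_support_subset hsupp
  have hTΨ : T ^ (1 / 3 : ℝ) = eLpNorm Ψ (ENNReal.ofReal 3) volume := by
    rw [show ENNReal.ofReal 3 = 3 by simp, eLpNorm_eq_lintegral_rpow_enorm_toReal (by norm_num) (by norm_num),
      ENNReal.toReal_ofNat, hTeq]
  have hTfin : T ^ (1 / 3 : ℝ) ≠ ∞ := by
    rw [hTΨ]
    exact (hΨ.continuous.memLp_of_hasCompactSupport hΨc).eLpNorm_ne_top
  have hbound : ‖∫ z in S, uncurry p z * Ψ z‖ₑ ≤ K * T ^ (1 / 3 : ℝ) := by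
    rw [hLHS, hid]
    refine enorm_sub_le.trans ?_
    calc _ ≤ L * volume (ball (0 : EuclideanSpace ℝ (Fin 3)) 1) * ENNReal.ofReal θ ^ 2 *
          cknD 1 0 p ^ (2 / 3 : ℝ) * T ^ (1 / 3 : ℝ) +
        9 * C₃ * CSP * cknAEss 1 0 u ^ (1 / 2 : ℝ) * cknE 1 0 G ^ (1 / 2 : ℝ) *
          ENNReal.ofReal θ ^ (1 / 3 : ℝ) * T ^ (1 / 3 : ℝ) := add_le_add hfar hcz
      _ = K * T ^ (1 / 3 : ℝ) := by rw [hK]; ring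
  calc |∫ z in S, uncurry p z * Ψ z| = ‖∫ z in S, uncurry p z * Ψ z‖ := (Real.norm_eq_abs _).symm
    _ = (‖∫ z in S, uncurry p z * Ψ z‖ₑ).toReal := (toReal_enorm _).symm
    _ ≤ (K * T ^ (1 / 3 : ℝ)).toReal := ENNReal.toReal_mono (ENNReal.mul_ne_top hKtop hTfin) hbound
    _ = K.toReal * (eLpNorm Ψ (ENNReal.ofReal 3) volume).toReal := by rw [ENNReal.toReal_mul, hTΨ]

end Duality

/-! ### The estimate at unit scale with absolute constants -/

section UnitScale

/-- `(c a^{1/2} e^{1/2} t^{1/3})^{3/2} = c^{3/2} a^{3/4} e^{3/4} t^{1/2}` in `ℝ≥0∞`. [folklore] -/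
theorem rpow_threeHalves_mul_sqrt_sqrt_cbrt (c a e t : ℝ≥0∞) :
    (c * a ^ (1 / 2 : ℝ) * e ^ (1 / 2 : ℝ) * t ^ (1 / 3 : ℝ)) ^ (3 / 2 : ℝ) =
      c ^ (3 / 2 : ℝ) * a ^ (3 / 4 : ℝ) * e ^ (3 / 4 : ℝ) * t ^ (1 / 2 : ℝ) := by
  rw [ENNReal.mul_rpow_of_nonneg _ _ (by norm_num : (0 : ℝ) ≤ 3 / 2),
    ENNReal.mul_rpow_of_nonneg _ _ (by norm_num : (0 : ℝ) ≤ 3 / 2),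
    ENNReal.mul_rpow_of_nonneg _ _ (by norm_num : (0 : ℝ) ≤ 3 / 2), ← ENNReal.rpow_mul,
    ← ENNReal.rpow_mul, ← ENNReal.rpow_mul]
  norm_num

/-- `(c t² d^{2/3})^{3/2} = c^{3/2} t³ d` in `ℝ≥0∞`. [folklore] -/
theorem rpow_threeHalves_mul_sq_rpow (c t d : ℝ≥0∞) :
    (c * t ^ 2 * d ^ (2 / 3 : ℝ)) ^ (3 / 2 : ℝ) = c ^ (3 / 2 : ℝ) * t ^ 3 * d := by
  rw [ENNReal.mul_rpow_of_nonneg _ _ (by norm_num : (0 : ℝ) ≤ 3 / 2),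
    ENNReal.mul_rpow_of_nonneg _ _ (by norm_num : (0 : ℝ) ≤ 3 / 2), ← ENNReal.rpow_mul,
    show (t ^ 2 : ℝ≥0∞) = t ^ (2 : ℝ) by rw [show (2 : ℝ) = ((2 : ℕ) : ℝ) by norm_num, ENNReal.rpow_natCast],
    ← ENNReal.rpow_mul, show (2 : ℝ) * (3 / 2) = ((3 : ℕ) : ℝ) by norm_num, ENNReal.rpow_natCast]
  norm_num

/-- `θ⁻² θ^{1/2} = θ^{-3/2}` for the `ℝ≥0∞`-valued parameter `ENNReal.ofReal θ`, `θ > 0`.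
[folklore] -/
theorem ofReal_sq_inv_mul_sqrt {θ : ℝ} (hθ : 0 < θ) :
    (ENNReal.ofReal θ ^ 2)⁻¹ * ENNReal.ofReal θ ^ (1 / 2 : ℝ) = ENNReal.ofReal (θ ^ (-(3 / 2 : ℝ))) := by
  have h0 : ENNReal.ofReal θ ≠ 0 := (ENNReal.ofReal_pos.2 hθ).ne'
  have ht : ENNReal.ofReal θ ≠ ∞ := ENNReal.ofReal_ne_top
  rw [← ENNReal.ofReal_rpow_of_pos hθ, show (-(3 / 2 : ℝ)) = -2 + 1 / 2 by norm_num,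
    ENNReal.rpow_add _ _ h0 ht, ENNReal.rpow_neg,
    show (ENNReal.ofReal θ ^ 2 : ℝ≥0∞) = ENNReal.ofReal θ ^ (2 : ℝ) by
      rw [show (2 : ℝ) = ((2 : ℕ) : ℝ) by norm_num, ENNReal.rpow_natCast]]

/-- `θ⁻² θ³ = θ` for `ENNReal.ofReal θ`, `θ > 0`. [folklore] -/
theorem ofReal_sq_inv_mul_cube {θ : ℝ} (hθ : 0 < θ) :
    (ENNReal.ofReal θ ^ 2)⁻¹ * ENNReal.ofReal θ ^ 3 = ENNReal.ofReal θ := by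
  have h0 : ENNReal.ofReal θ ^ 2 ≠ 0 := pow_ne_zero _ (ENNReal.ofReal_pos.2 hθ).ne'
  have ht : ENNReal.ofReal θ ^ 2 ≠ ∞ := ENNReal.pow_ne_top ENNReal.ofReal_ne_top
  rw [show ENNReal.ofReal θ ^ 3 = ENNReal.ofReal θ ^ 2 * ENNReal.ofReal θ by ring, ← mul_assoc,
    ENNReal.inv_mul_cancel h0 ht, one_mul]

/-- **Robinson–Rodrigo–Sadowski 2016, Lemma 16.7, at unit scale** (`r = 1`, `z = 0`): there
are absolute `κ₅, κ₆` with `D(θ) ≤ κ₅ θ^{-3/2} A(1)^{3/4} E(1)^{3/4} + κ₆ θ D(1)` for every suitable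
weak solution (`ν = 1`) with locally integrable divergence-free force, every weak spatial
gradient, `closure Q₁ ⊆ Q` and `θ ∈ (0, 1/2]` (from `setLIntegral_pressure_rpow_le_unitScale`
with Stein's constant `stein1970_hessian_Lp_bound_holds_fin3`, the Sobolev–Poincaré constant of
`exists_eLpNorm_sub_average_six_le_unitBall` and a bound for `λ_{1/4,1/2}`; then
`(X + Y)^{3/2} ≤ 2^{1/2}(X^{3/2} + Y^{3/2})` and division by `θ²`).
[cite: RobinsonRodrigoSadowski2016, Lemma 16.7] -/
theorem pressureEstimate_unitScale :
    ∃ κ₅ κ₆ : ℝ≥0, ∀ (Q : Opens (ℝ × EuclideanSpace ℝ (Fin 3)))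
      (f u : ℝ → EuclideanSpace ℝ (Fin 3) → EuclideanSpace ℝ (Fin 3))
      (p : ℝ → EuclideanSpace ℝ (Fin 3) → ℝ)
      (G : ℝ → EuclideanSpace ℝ (Fin 3) → EuclideanSpace ℝ (Fin 3) →L[ℝ] EuclideanSpace ℝ (Fin 3)),
      IsSuitableWeakSolutionOn Q 1 f u p →
      LocallyIntegrableOn (uncurry f) (Q : Set (ℝ × EuclideanSpace ℝ (Fin 3))) volume →
      (∀ φ : ℝ → EuclideanSpace ℝ (Fin 3) → ℝ, IsSpaceTimeTestOn Q φ →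
        ∫ t, ∫ x, ⟪f t x, gradient (φ t) x⟫ = 0) →
      HasWeakSpatialGradientOn Q u G →
      closure (parabolicCylinder 1 (0 : ℝ × EuclideanSpace ℝ (Fin 3))) ⊆
        (Q : Set (ℝ × EuclideanSpace ℝ (Fin 3))) →
      ∀ θ : ℝ, 0 < θ → θ ≤ 1 / 2 →
        cknD θ 0 p ≤
          κ₅ * ENNReal.ofReal (θ ^ (-(3 / 2 : ℝ))) * cknAEss 1 0 u ^ (3 / 4 : ℝ) *
              cknE 1 0 G ^ (3 / 4 : ℝ) +
            κ₆ * ENNReal.ofReal θ * cknD 1 0 p := by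
  -- the three constants
  have h13 : (1 : ℝ≥0∞) < 3 := by norm_num
  have h3top : (3 : ℝ≥0∞) < ⊤ := ENNReal.ofNat_lt_top
  obtain ⟨C₃, hC₃⟩ := stein1970_hessian_Lp_bound_holds_fin3.hessian_newtonNearPotential_half h13 h3top
  obtain ⟨CSP, hCSP⟩ := FunctionSpaces.exists_eLpNorm_sub_average_six_le_unitBall
    (E' := EuclideanSpace ℝ (Fin 3)) (F := EuclideanSpace ℝ (Fin 3)) finrank_euclideanSpace_fin
  have h₀ : (0 : ℝ) < (1 / 2 : ℝ) / 2 := by norm_num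
  have h₁ : (1 / 2 : ℝ) / 2 < 1 / 2 := by norm_num
  obtain ⟨L₀, hL₀⟩ := (continuous_newtonFarLaplacian h₀ h₁).bounded_above_of_compact_support
    (hasCompactSupport_newtonFarLaplacian h₀.le h₁)
  set L : ℝ≥0 := L₀.toNNReal with hLdef
  have hL : ∀ z, ‖newtonFarLaplacian ((1 / 2 : ℝ) / 2) (1 / 2) z‖ ≤ L := fun z =>
    (hL₀ z).trans (Real.le_coe_toNNReal L₀)
  set vB : ℝ≥0 := (volume (ball (0 : EuclideanSpace ℝ (Fin 3)) 1)).toNNReal with hvB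
  have hvBeq : (vB : ℝ≥0∞) = volume (ball (0 : EuclideanSpace ℝ (Fin 3)) 1) :=
    ENNReal.coe_toNNReal measure_ball_lt_top.ne
  set c₁ : ℝ≥0 := 9 * C₃ * CSP with hc₁
  set c₂ : ℝ≥0 := L * vB with hc₂
  refine ⟨(2 : ℝ≥0) ^ (1 / 2 : ℝ) * c₁ ^ (3 / 2 : ℝ), (2 : ℝ≥0) ^ (1 / 2 : ℝ) * c₂ ^ (3 / 2 : ℝ),
    fun Q f u p G hsol hfi hdivf hG hcl θ hθ hθ2 => ?_⟩
  have key := setLIntegral_pressure_rpow_le_unitScale hC₃ hCSP hL hsol hfi hdivf hG hcl hθ hθ2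
  set A := cknAEss 1 0 u with hAdef
  set EE := cknE 1 0 G with hEdef
  set D := cknD 1 0 p with hDdef
  set t := ENNReal.ofReal θ with ht
  set X : ℝ≥0∞ := (c₁ : ℝ≥0∞) * A ^ (1 / 2 : ℝ) * EE ^ (1 / 2 : ℝ) * t ^ (1 / 3 : ℝ) with hX
  set Y : ℝ≥0∞ := (c₂ : ℝ≥0∞) * t ^ 2 * D ^ (2 / 3 : ℝ) with hY
  have hkey' : ∫⁻ z in parabolicCylinder θ (0 : ℝ × EuclideanSpace ℝ (Fin 3)), ‖p z.1 z.2‖ₑ ^ (3 / 2 : ℝ) ≤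
      (X + Y) ^ (3 / 2 : ℝ) := by
    refine key.trans (le_of_eq ?_)
    congr 1
    rw [hX, hY, hc₁, hc₂]
    push_cast
    rw [hvBeq]
  have hsplit : (X + Y) ^ (3 / 2 : ℝ) ≤ (2 : ℝ≥0∞) ^ (1 / 2 : ℝ) * (X ^ (3 / 2 : ℝ) + Y ^ (3 / 2 : ℝ)) := by
    have := ENNReal.rpow_add_le_mul_rpow_add_rpow X Y (p := 3 / 2) (by norm_num)
    rwa [show (3 / 2 - 1 : ℝ) = 1 / 2 by norm_num] at this
  have hXp : X ^ (3 / 2 : ℝ) = (c₁ : ℝ≥0∞) ^ (3 / 2 : ℝ) * A ^ (3 / 4 : ℝ) * EE ^ (3 / 4 : ℝ) * t ^ (1 / 2 : ℝ) :=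
    rpow_threeHalves_mul_sqrt_sqrt_cbrt _ _ _ _
  have hYp : Y ^ (3 / 2 : ℝ) = (c₂ : ℝ≥0∞) ^ (3 / 2 : ℝ) * t ^ 3 * D := rpow_threeHalves_mul_sq_rpow _ _ _
  -- divide by `θ²`
  have hDθ : cknD θ 0 p = (t ^ 2)⁻¹ *
      ∫⁻ z in parabolicCylinder θ (0 : ℝ × EuclideanSpace ℝ (Fin 3)), ‖p z.1 z.2‖ₑ ^ (3 / 2 : ℝ) := rfl
  have e5 : (((2 : ℝ≥0) ^ (1 / 2 : ℝ) * c₁ ^ (3 / 2 : ℝ) : ℝ≥0) : ℝ≥0∞) =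
      (2 : ℝ≥0∞) ^ (1 / 2 : ℝ) * (c₁ : ℝ≥0∞) ^ (3 / 2 : ℝ) := by
    rw [ENNReal.coe_mul, ENNReal.coe_rpow_of_nonneg _ (by norm_num), ENNReal.coe_rpow_of_nonneg _ (by norm_num)]
    rfl
  have e6 : (((2 : ℝ≥0) ^ (1 / 2 : ℝ) * c₂ ^ (3 / 2 : ℝ) : ℝ≥0) : ℝ≥0∞) =
      (2 : ℝ≥0∞) ^ (1 / 2 : ℝ) * (c₂ : ℝ≥0∞) ^ (3 / 2 : ℝ) := by
    rw [ENNReal.coe_mul, ENNReal.coe_rpow_of_nonneg _ (by norm_num), ENNReal.coe_rpow_of_nonneg _ (by norm_num)]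
    rfl
  rw [e5, e6]
  calc cknD θ 0 p ≤ (t ^ 2)⁻¹ * ((2 : ℝ≥0∞) ^ (1 / 2 : ℝ) * (X ^ (3 / 2 : ℝ) + Y ^ (3 / 2 : ℝ))) := by
        rw [hDθ]; exact mul_le_mul' le_rfl (hkey'.trans hsplit)
    _ = (2 : ℝ≥0∞) ^ (1 / 2 : ℝ) * (c₁ : ℝ≥0∞) ^ (3 / 2 : ℝ) * ((t ^ 2)⁻¹ * t ^ (1 / 2 : ℝ)) *
          A ^ (3 / 4 : ℝ) * EE ^ (3 / 4 : ℝ) +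
        (2 : ℝ≥0∞) ^ (1 / 2 : ℝ) * (c₂ : ℝ≥0∞) ^ (3 / 2 : ℝ) * ((t ^ 2)⁻¹ * t ^ 3) * D := by
        rw [hXp, hYp]; ring
    _ = _ := by rw [ht, ofReal_sq_inv_mul_sqrt hθ, ofReal_sq_inv_mul_cube hθ]

end UnitScale

/-! ### Parabolic scaling and the discharge of `pressureEstimate` -/

section Scaling

/-- **The iterated divergence condition is scale invariant**: if `∫ (∫ ⟪f, ∇φ⟫ dx) dt = 0` for all
test functions on `Q`, then the zoomed force `r³ f ∘ Φ`, `Φ(s, y) = (t₀ + r²s, x₀ + ry)`,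
satisfies the same condition on `Φ⁻¹(Q)` (change of variables in each of the two integrals).
[folklore] -/
theorem iterated_inner_gradient_eq_zero_stPull
    {Q : Opens (ℝ × EuclideanSpace ℝ (Fin 3))}
    {f : ℝ → EuclideanSpace ℝ (Fin 3) → EuclideanSpace ℝ (Fin 3)}
    (hdivf : ∀ φ : ℝ → EuclideanSpace ℝ (Fin 3) → ℝ, IsSpaceTimeTestOn Q φ →
      ∫ t, ∫ x, ⟪f t x, gradient (φ t) x⟫ = 0)
    {r : ℝ} (hr : 0 < r) (z : ℝ × EuclideanSpace ℝ (Fin 3)) :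
    ∀ φ : ℝ → EuclideanSpace ℝ (Fin 3) → ℝ, IsSpaceTimeTestOn (stPreimage (r ^ 2) r z.1 z.2 Q) φ →
      ∫ t, ∫ x, ⟪(r ^ 3 • stPull (r ^ 2) r z.1 z.2 f) t x, gradient (φ t) x⟫ = 0 := by
  intro φ hφ
  have hr2 : (0 : ℝ) < r ^ 2 := by positivity
  set ψ := stPull (r ^ 2)⁻¹ r⁻¹ (-((r ^ 2)⁻¹ * z.1)) (-(r⁻¹ • z.2)) φ with hψ
  have hψQ : IsSpaceTimeTestOn Q ψ := hφ.stPull_symm hr2.ne' hr.ne'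
  have hrepr : φ = stPull (r ^ 2) r z.1 z.2 ψ := (stPull_stPull_symm hr2.ne' hr.ne' z.1 z.2 φ).symm
  have hzero := hdivf ψ hψQ
  have key : ∀ t x, ⟪(r ^ 3 • stPull (r ^ 2) r z.1 z.2 f) t x, gradient (φ t) x⟫ =
      r ^ 4 * ⟪f (z.1 + r ^ 2 * t) (z.2 + r • x), gradient (ψ (z.1 + r ^ 2 * t)) (z.2 + r • x)⟫ := by
    intro t x
    conv_lhs => rw [hrepr]
    rw [gradient_stPull, smul_stPull_apply, real_inner_smul_left, real_inner_smul_right]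
    ring
  simp_rw [key]
  have hinner : ∀ t, ∫ x, r ^ 4 * ⟪f (z.1 + r ^ 2 * t) (z.2 + r • x),
      gradient (ψ (z.1 + r ^ 2 * t)) (z.2 + r • x)⟫ =
      r ^ 4 * ((r ^ 3)⁻¹ * ∫ y, ⟪f (z.1 + r ^ 2 * t) y, gradient (ψ (z.1 + r ^ 2 * t)) y⟫) := by
    intro t
    rw [integral_const_mul]
    congr 1
    have := integral_comp_space_affine hr z.2
      (fun y => ⟪f (z.1 + r ^ 2 * t) y, gradient (ψ (z.1 + r ^ 2 * t)) y⟫)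
    rw [finrank_euclideanSpace_fin, smul_eq_mul] at this
    exact this
  simp_rw [hinner]
  have htime : ∫ t, r ^ 4 * ((r ^ 3)⁻¹ * ∫ y, ⟪f (z.1 + r ^ 2 * t) y, gradient (ψ (z.1 + r ^ 2 * t)) y⟫) =
      r ^ 4 * ((r ^ 3)⁻¹ * ((r ^ 2)⁻¹ * ∫ s, ∫ y, ⟪f s y, gradient (ψ s) y⟫)) := by
    rw [integral_const_mul, integral_const_mul]
    congr 2
    have := integral_comp_time_affine hr2 z.1 (fun s => ∫ y, ⟪f s y, gradient (ψ s) y⟫)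
    rw [smul_eq_mul] at this
    exact this
  rw [htime, hzero, mul_zero, mul_zero, mul_zero]

/-- **Reduction of `pressureEstimate` to the unit cylinder at the origin** (parabolic scaling,
Caffarelli–Kohn–Nirenberg 1982, §2; Robinson–Rodrigo–Sadowski 2016, proof of Lemma 16.7: "It
suffices to prove the estimate with `r = 1`, the result for general `r` following by
rescaling"): the zoomed solution `u_r = r u ∘ Φ`, `p_r = r² p ∘ Φ`, `f_r = r³ f ∘ Φ` is again
suitable with locally integrable divergence-free force, and `D`, `A`, `E` are scale invariant
(`cknD_nsZoom`, `cknAEss_nsZoom`, `cknE_nsZoom`). [cite: RobinsonRodrigoSadowski2016, proof of Lemma 16.7 p. 252] -/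
theorem pressureEstimate_of_unitScale
    (H : ∃ κ₅ κ₆ : ℝ≥0, ∀ (Q : Opens (ℝ × EuclideanSpace ℝ (Fin 3)))
      (f u : ℝ → EuclideanSpace ℝ (Fin 3) → EuclideanSpace ℝ (Fin 3))
      (p : ℝ → EuclideanSpace ℝ (Fin 3) → ℝ)
      (G : ℝ → EuclideanSpace ℝ (Fin 3) → EuclideanSpace ℝ (Fin 3) →L[ℝ] EuclideanSpace ℝ (Fin 3)),
      IsSuitableWeakSolutionOn Q 1 f u p →
      LocallyIntegrableOn (uncurry f) (Q : Set (ℝ × EuclideanSpace ℝ (Fin 3))) volume →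
      (∀ φ : ℝ → EuclideanSpace ℝ (Fin 3) → ℝ, IsSpaceTimeTestOn Q φ →
        ∫ t, ∫ x, ⟪f t x, gradient (φ t) x⟫ = 0) →
      HasWeakSpatialGradientOn Q u G →
      closure (parabolicCylinder 1 (0 : ℝ × EuclideanSpace ℝ (Fin 3))) ⊆
        (Q : Set (ℝ × EuclideanSpace ℝ (Fin 3))) →
      ∀ θ : ℝ, 0 < θ → θ ≤ 1 / 2 →
        cknD θ 0 p ≤
          κ₅ * ENNReal.ofReal (θ ^ (-(3 / 2 : ℝ))) * cknAEss 1 0 u ^ (3 / 4 : ℝ) *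
              cknE 1 0 G ^ (3 / 4 : ℝ) +
            κ₆ * ENNReal.ofReal θ * cknD 1 0 p) :
    pressureEstimate := by
  obtain ⟨κ₅, κ₆, H⟩ := H
  refine ⟨κ₅, κ₆, fun Q f u p G hsol hfi hdivf hG z r θ hr hθ hθ' hcl => ?_⟩
  -- the zoomed data
  set Q' := stPreimage (r ^ 2) r z.1 z.2 Q with hQ'
  set u' := r • stPull (r ^ 2) r z.1 z.2 u with hu'
  set p' := r ^ 2 • stPull (r ^ 2) r z.1 z.2 p with hp'
  set f' := r ^ 3 • stPull (r ^ 2) r z.1 z.2 f with hf'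
  set G' := r ^ 2 • stPull (r ^ 2) r z.1 z.2 G with hG'
  have hr2 : (0 : ℝ) < r ^ 2 := by positivity
  have hsol' : IsSuitableWeakSolutionOn Q' 1 f' u' p' := by
    have := hsol.stRescale (α := r) (β := r ^ 2) (γ := r) hr hr (by ring) z.1 z.2
    rwa [show r * 1 / r = 1 by field_simp, show r ^ 2 * r = r ^ 3 by ring] at this
  have hfi' : LocallyIntegrableOn (uncurry f') (Q' : Set (ℝ × EuclideanSpace ℝ (Fin 3))) volume := by
    have := (hfi.uncurry_stPull hr2 hr z.1 z.2).smul (r ^ 3)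
    exact this
  have hdivf' := iterated_inner_gradient_eq_zero_stPull hdivf hr z
  have hG'' : HasWeakSpatialGradientOn Q' u' G' := by
    have := hG.stRescale r hr2 hr z.1 z.2
    rwa [← sq] at this
  have hcl' := closure_parabolicCylinder_one_subset_stPreimage hr hcl
  have key := H Q' f' u' p' G' hsol' hfi' hdivf' hG'' hcl' θ hθ hθ'
  -- transport the quantities back
  have hz : stAffine (r ^ 2) r z.1 z.2 (0 : ℝ × EuclideanSpace ℝ (Fin 3)) = z :=
    Prod.ext (by simp [stAffine]) (by simp [stAffine])
  have hA : cknAEss 1 0 u' = cknAEss r z u := by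
    rw [hu', cknAEss_nsZoom hr one_pos z.1 z.2 0 u, hz, mul_one]
  have hE : cknE 1 0 G' = cknE r z G := by
    rw [hG', cknE_nsZoom hr one_pos z.1 z.2 0 G, hz, mul_one]
  have hD : ∀ ρ : ℝ, 0 < ρ → cknD ρ 0 p' = cknD (ρ * r) z p := fun ρ hρ => by
    rw [hp', cknD_nsZoom hr hρ z.1 z.2 0 p, hz, mul_comm]
  rw [hD θ hθ, hA, hE, hD 1 one_pos, one_mul] at key
  exact key

/-- **Discharge of the decomposition target `pressureEstimate`** of
`CKNEpsilonRegularityAssembly.lean` (Robinson–Rodrigo–Sadowski 2016, Lemma 16.7, after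
Kukavica 2009): the third of the four hypotheses of
`Literature.Analysis.FluidPDE.ckn_epsilon_regularity_of_estimates` is now a theorem (unit scale
`pressureEstimate_unitScale` by duality and Calderón–Zygmund, and parabolic scaling
`pressureEstimate_of_unitScale`). [cite: RobinsonRodrigoSadowski2016, Lemma 16.7] -/
theorem pressureEstimate_holds : pressureEstimate :=
  pressureEstimate_of_unitScale pressureEstimate_unitScale

end Scaling

end Literature.Analysis.FluidPDE

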